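import Mathlib.Analysis.Normed.Group.Tannery
import Mathlib.Analysis.SpecificLimits.Normed
import Mathlib.Analysis.Complex.Basic
import HarnessLib

/-!
# Route SignCone, item `ExactConeRigidity` (stmt-RiemannHypothesis-16306): positive-definite sequences —
the Toeplitz double sum and the positivity of the geometric generating function

Pure sequence algebra/analysis for the CARATHÉODORY DESCRIPTION of cone weights (archive 2001 fefr Thm A:
for an exact-cone weight `c`, `Re (1/s + 1/(s-1) - ½ log π + ½ ψ(s/2) - Σ c(n) n^{-s}) ≥ 0` on `Re s > 1/2`).
The fake Weil form of a cone weight, evaluated along the translates `G(· - x)` of an autocorrelation kernel, is a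
POSITIVE-DEFINITE FUNCTION `a` of `x` (finite combs of translates of one test function are test functions). This
file isolates what positive-definiteness of the sampled sequence `m ↦ a(mδ)` gives:

* `toeplitz_double_sum` — the Toeplitz identity
  `Σ_{j,k<N} w^j (conj w)^k T(j,k) = Σ_{m<N} u(m) w^m G(N-m) + Σ_{1≤m<N} v(m) (conj w)^m G(N-m)`
  for `T(j,k) = u(j-k)` (`k ≤ j`), `= v(k-j)` (`k > j`), `G(L) = Σ_{k<L} (w conj w)^k`;
* `re_geom_generating_nonneg` — if `u` is bounded, `v = conj ∘ u`, `‖w‖ < 1` and all the Toeplitz double sums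
  have nonnegative real part, then `0 ≤ Re (2 Σ_{m} u(m) w^m - u(0))` (let `N → ∞`, Tannery's theorem).
-/

noncomputable section

-- `Summit.RiemannHypothesis.RiemannHypothesis.…` repeats a namespace component by design (D-0017 layout).
set_option linter.dupNamespace false

open Complex Filter Topology Finset
open scoped ComplexConjugate BigOperators

namespace Summit.RiemannHypothesis.RiemannHypothesis.Theorems.SignConeExactConeRigidity

/-! ## The Toeplitz double sum -/

/-- Partial geometric sums `G(L) = Σ_{k<L} r^k` satisfy `G(L+1) = G(L) + r^L`. -/
theorem geomPartial_succ (r : ℂ) (L : ℕ) :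
    ∑ k ∈ range (L + 1), r ^ k = ∑ k ∈ range L, r ^ k + r ^ L :=
  sum_range_succ _ _

/-- **Toeplitz double sum.** For `u v : ℕ → ℂ`, `w : ℂ` and the Toeplitz matrix `T(j,k) = u(j-k)` if
`k ≤ j`, `T(j,k) = v(k-j)` if `j < k`:
`Σ_{j<N} Σ_{k<N} w^j (conj w)^k T(j,k) = Σ_{m<N} u(m) w^m G(N-m) + Σ_{m ∈ [1,N)} v(m) (conj w)^m G(N-m)`,
where `G(L) = Σ_{k<L} (w conj w)^k` (group the pairs `(j,k)` by `m = j - k`; induction on `N`). -/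
theorem toeplitz_double_sum (u v : ℕ → ℂ) (w : ℂ) (N : ℕ) :
    ∑ j ∈ range N, ∑ k ∈ range N,
        w ^ j * conj w ^ k * (if k ≤ j then u (j - k) else v (k - j)) =
      ∑ m ∈ range N, u m * w ^ m * ∑ k ∈ range (N - m), (w * conj w) ^ k +
        ∑ m ∈ Ico 1 N, v m * conj w ^ m * ∑ k ∈ range (N - m), (w * conj w) ^ k := by
  induction N with
  | zero => simp
  | succ N ih =>
    -- split off the last row `j = N` and the last column `k = N`
    rw [sum_range_succ, sum_congr rfl fun j _ => sum_range_succ _ _, sum_add_distrib, ih]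
    -- the last row: `Σ_{k ≤ N} w^N (conj w)^k u(N-k) = Σ_{m ≤ N} u(m) w^m (w conj w)^(N-m)`
    have hrow : ∑ k ∈ range (N + 1), w ^ N * conj w ^ k * (if k ≤ N then u (N - k) else v (k - N)) =
        ∑ m ∈ range (N + 1), u m * w ^ m * (w * conj w) ^ (N - m) := by
      rw [← sum_range_reflect (fun m => u m * w ^ m * (w * conj w) ^ (N - m)) (N + 1)]
      refine sum_congr rfl fun k hk => ?_
      have hk' : k ≤ N := Nat.lt_succ_iff.1 (mem_range.1 hk)
      rw [if_pos hk', show N + 1 - 1 - k = N - k from by omega, Nat.sub_sub_self hk', mul_pow]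
      have : w ^ N = w ^ (N - k) * w ^ k := by rw [← pow_add, Nat.sub_add_cancel hk']
      rw [this]
      ring
    -- the last column: `Σ_{j<N} w^j (conj w)^N v(N-j) = Σ_{m ∈ [1,N]} v(m) (conj w)^m (w conj w)^(N-m)`
    have hcol : ∑ j ∈ range N, w ^ j * conj w ^ N * (if N ≤ j then u (j - N) else v (N - j)) =
        ∑ m ∈ Ico 1 (N + 1), v m * conj w ^ m * (w * conj w) ^ (N - m) := by
      have hsplit : ∑ m ∈ Ico 1 (N + 1), v m * conj w ^ m * (w * conj w) ^ (N - m) =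
          ∑ m ∈ range (N + 1), (if m = 0 then 0 else v m * conj w ^ m * (w * conj w) ^ (N - m)) := by
        rw [range_eq_Ico, sum_eq_sum_Ico_succ_bot (Nat.succ_pos N), if_pos rfl, zero_add]
        refine sum_congr rfl fun m hm => ?_
        rw [if_neg (by have := (mem_Ico.1 hm).1; omega)]
      rw [hsplit, ← sum_range_reflect _ (N + 1), sum_range_succ]
      have hlast : (if N + 1 - 1 - N = 0 then (0 : ℂ)
          else v (N + 1 - 1 - N) * conj w ^ (N + 1 - 1 - N) * (w * conj w) ^ (N - (N + 1 - 1 - N))) = 0 := by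
        rw [if_pos (by omega)]
      rw [hlast, add_zero]
      refine sum_congr rfl fun j hj => ?_
      have hj' : j < N := mem_range.1 hj
      rw [if_neg (by omega), if_neg (by omega), show N + 1 - 1 - j = N - j from by omega,
        Nat.sub_sub_self hj'.le, mul_pow]
      have : conj w ^ N = conj w ^ (N - j) * conj w ^ j := by rw [← pow_add, Nat.sub_add_cancel hj'.le]
      rw [this]
      ring
    rw [hrow, hcol]
    -- the right-hand side at `N + 1` minus the one at `N`
    have hu : ∑ m ∈ range (N + 1), u m * w ^ m * ∑ k ∈ range (N + 1 - m), (w * conj w) ^ k =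
        ∑ m ∈ range N, u m * w ^ m * ∑ k ∈ range (N - m), (w * conj w) ^ k +
          ∑ m ∈ range (N + 1), u m * w ^ m * (w * conj w) ^ (N - m) := by
      rw [sum_range_succ, sum_range_succ (fun m => u m * w ^ m * (w * conj w) ^ (N - m)), ← add_assoc,
        ← sum_add_distrib, Nat.sub_self, pow_zero, show N + 1 - N = 1 from by omega, sum_range_one, pow_zero]
      congr 1
      refine sum_congr rfl fun m hm => ?_
      have hm' : m < N := mem_range.1 hm
      rw [show N + 1 - m = (N - m) + 1 from by omega, geomPartial_succ]
      ring
    have hv : ∑ m ∈ Ico 1 (N + 1), v m * conj w ^ m * ∑ k ∈ range (N + 1 - m), (w * conj w) ^ k =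
        ∑ m ∈ Ico 1 N, v m * conj w ^ m * ∑ k ∈ range (N - m), (w * conj w) ^ k +
          ∑ m ∈ Ico 1 (N + 1), v m * conj w ^ m * (w * conj w) ^ (N - m) := by
      rcases Nat.eq_zero_or_pos N with rfl | hN
      · simp
      rw [sum_Ico_succ_top hN, sum_Ico_succ_top hN (fun m => v m * conj w ^ m * (w * conj w) ^ (N - m)),
        ← add_assoc, ← sum_add_distrib, Nat.sub_self, pow_zero, show N + 1 - N = 1 from by omega,
        sum_range_one, pow_zero]
      congr 1
      refine sum_congr rfl fun m hm => ?_
      have hm' : m < N := (mem_Ico.1 hm).2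
      rw [show N + 1 - m = (N - m) + 1 from by omega, geomPartial_succ]
      ring
    rw [hu, hv]
    ring

/-! ## Positivity of the geometric generating function -/

/-- For `‖w‖ < 1` the partial geometric sums of `w conj w = ‖w‖²` converge to `1/(1 - ‖w‖²)`, are real,
nonnegative and bounded by the limit. -/
theorem geomPartial_normSq_tendsto {w : ℂ} (hw : ‖w‖ < 1) :
    Tendsto (fun L : ℕ => ∑ k ∈ range L, (w * conj w) ^ k) atTop (𝓝 (1 / (1 - w * conj w))) := by
  have hr : ‖w * conj w‖ < 1 := by
    rw [norm_mul, Complex.norm_conj, ← sq]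
    exact (sq_lt_one_iff₀ (norm_nonneg _)).2 hw
  have h := hasSum_geometric_of_norm_lt_one hr
  rw [one_div]
  exact h.tendsto_sum_nat

/-- `‖Σ_{k<L} (w conj w)^k‖ ≤ 1/(1 - ‖w‖²)` for `‖w‖ < 1`. -/
theorem norm_geomPartial_normSq_le {w : ℂ} (hw : ‖w‖ < 1) (L : ℕ) :
    ‖∑ k ∈ range L, (w * conj w) ^ k‖ ≤ 1 / (1 - ‖w‖ ^ 2) := by
  have hwc : w * conj w = ((‖w‖ ^ 2 : ℝ) : ℂ) := by
    rw [Complex.mul_conj, Complex.normSq_eq_norm_sq]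
  have hq : ‖w‖ ^ 2 < 1 := (sq_lt_one_iff₀ (norm_nonneg _)).2 hw
  have hq0 : 0 ≤ ‖w‖ ^ 2 := sq_nonneg _
  rw [hwc]
  have : ∑ k ∈ range L, (((‖w‖ ^ 2 : ℝ) : ℂ)) ^ k = ((∑ k ∈ range L, (‖w‖ ^ 2) ^ k : ℝ) : ℂ) := by
    push_cast
    rfl
  rw [this, Complex.norm_real, Real.norm_of_nonneg (sum_nonneg fun k _ => pow_nonneg hq0 k)]
  have hle := (summable_geometric_of_lt_one hq0 hq).sum_le_tsum (range L) (fun k _ => pow_nonneg hq0 k)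
  rwa [tsum_geometric_of_lt_one hq0 hq, ← one_div] at hle

/-- **Positivity of the generating function of a bounded positive-definite sequence.** Let `u : ℕ → ℂ`
be bounded and put `v = conj ∘ u` (so that `T(j,k) = u(j-k)` / `conj u(k-j)` is a hermitian Toeplitz matrix).
If every Toeplitz double sum `Σ_{j,k<N} w^j (conj w)^k T(j,k)` has nonnegative real part (`‖w‖ < 1` fixed),
then `0 ≤ Re (2 Σ_m u(m) w^m - u(0))`. Proof: by `toeplitz_double_sum` the double sum is
`u(0) G(N) + Σ_{1≤m<N} (u(m) w^m + conj(u(m) w^m)) G(N-m)`, whose real part is that of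
`Σ_{m<N} ε_m u(m) w^m G(N-m)` (`ε₀ = 1`, `ε_m = 2`); as `N → ∞` this tends to `(2 Σ u(m) w^m - u(0))/(1 - ‖w‖²)`
(Tannery's theorem, dominated by `2B‖w‖^m/(1-‖w‖²)`). -/
theorem re_geom_generating_nonneg {u : ℕ → ℂ} {B : ℝ} (hB : ∀ m, ‖u m‖ ≤ B) {w : ℂ} (hw : ‖w‖ < 1)
    (hpd : ∀ N : ℕ, 0 ≤ (∑ j ∈ range N, ∑ k ∈ range N,
      w ^ j * conj w ^ k * (if k ≤ j then u (j - k) else conj (u (k - j)))).re) :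
    0 ≤ (2 * ∑' m : ℕ, u m * w ^ m - u 0).re := by
  have hB0 : 0 ≤ B := (norm_nonneg _).trans (hB 0)
  have hq : ‖w‖ ^ 2 < 1 := (sq_lt_one_iff₀ (norm_nonneg _)).2 hw
  have hq1 : 0 < 1 - ‖w‖ ^ 2 := by linarith
  set r : ℂ := w * conj w with hr
  set G : ℕ → ℂ := fun L => ∑ k ∈ range L, r ^ k with hG
  have hGreal : ∀ L, conj (G L) = G L := fun L => by
    simp only [hG, map_sum, map_pow, hr, map_mul, Complex.conj_conj]
    refine sum_congr rfl fun k _ => ?_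
    rw [mul_comm]
  -- the weights `ε₀ = 1`, `ε_m = 2`
  set ε : ℕ → ℂ := fun m => if m = 0 then 1 else 2 with hε
  have hεn : ∀ m, ‖ε m‖ ≤ 2 := fun m => by
    simp only [hε]; split_ifs <;> simp
  -- real part of the double sum = real part of `Σ_{m<N} ε_m u(m) w^m G(N-m)`
  have hre : ∀ N : ℕ, (∑ j ∈ range N, ∑ k ∈ range N,
      w ^ j * conj w ^ k * (if k ≤ j then u (j - k) else conj (u (k - j)))).re =
      (∑' m : ℕ, if m < N then ε m * (u m * w ^ m) * G (N - m) else 0).re := by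
    intro N
    rw [toeplitz_double_sum u (fun m => conj (u m)) w N]
    rw [tsum_eq_sum (s := range N) (fun m hm => if_neg (by simpa using hm))]
    have h1 : ∑ m ∈ range N, (if m < N then ε m * (u m * w ^ m) * G (N - m) else 0) =
        ∑ m ∈ range N, ε m * (u m * w ^ m) * G (N - m) :=
      sum_congr rfl fun m hm => if_pos (mem_range.1 hm)
    rw [h1]
    -- the `v`-part is the conjugate of the `u`-part over `Ico 1 N`
    have h2 : ∑ m ∈ Ico 1 N, conj (u m) * conj w ^ m * G (N - m) =
        conj (∑ m ∈ Ico 1 N, u m * w ^ m * G (N - m)) := by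
      rw [map_sum]
      refine sum_congr rfl fun m _ => ?_
      rw [map_mul, map_mul, map_pow, hGreal]
    rw [h2, Complex.add_re, Complex.conj_re]
    -- split the `u`-part and the `ε`-sum at `m = 0`
    rcases Nat.eq_zero_or_pos N with rfl | hN
    · simp
    rw [range_eq_Ico, sum_eq_sum_Ico_succ_bot hN, sum_eq_sum_Ico_succ_bot hN]
    simp only [hε, if_pos rfl, one_mul, Complex.add_re, re_sum]
    have h3 : ∀ m ∈ Ico 1 N, ((if m = 0 then (1 : ℂ) else 2) * (u m * w ^ m) * G (N - m)).re =
        2 * (u m * w ^ m * G (N - m)).re := by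
      intro m hm
      rw [if_neg (by have := (mem_Ico.1 hm).1; omega)]
      simp [Complex.mul_re, mul_assoc]
    rw [sum_congr rfl h3, ← mul_sum]
    ring
  -- Tannery: the `ε`-sums converge to `Σ ε_m u(m) w^m / (1 - r)`
  have hGt : ∀ m : ℕ, Tendsto (fun N : ℕ => G (N - m)) atTop (𝓝 (1 / (1 - r))) := fun m =>
    (geomPartial_normSq_tendsto hw).comp (tendsto_sub_atTop_nat m)
  have hlim : Tendsto (fun N : ℕ => ∑' m : ℕ, if m < N then ε m * (u m * w ^ m) * G (N - m) else 0) atTop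
      (𝓝 (∑' m : ℕ, ε m * (u m * w ^ m) * (1 / (1 - r)))) := by
    refine tendsto_tsum_of_dominated_convergence (bound := fun m => 2 * (B * ‖w‖ ^ m) * (1 / (1 - ‖w‖ ^ 2)))
      ?_ ?_ ?_
    · exact ((summable_geometric_of_lt_one (norm_nonneg _) hw).mul_left B |>.mul_left 2).mul_right _
    · intro m
      have hev : ∀ᶠ N : ℕ in atTop, (if m < N then ε m * (u m * w ^ m) * G (N - m) else 0) =
          ε m * (u m * w ^ m) * G (N - m) :=
        (eventually_gt_atTop m).mono fun N hN => if_pos hN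
      exact (tendsto_const_nhds.mul (hGt m)).congr' (EventuallyEq.symm hev)
    · refine Eventually.of_forall fun N m => ?_
      split_ifs with h
      · rw [norm_mul, norm_mul, norm_mul, norm_pow]
        refine mul_le_mul (mul_le_mul (hεn m) (mul_le_mul_of_nonneg_right (hB m) (pow_nonneg (norm_nonneg _) _))
          (by positivity) zero_le_two) (norm_geomPartial_normSq_le hw _) (norm_nonneg _) (by positivity)
      · rw [norm_zero]; positivity
  -- pass to the limit in `0 ≤ Re`
  have hlim_re := (Complex.continuous_re.tendsto _).comp hlim
  have hnonneg : 0 ≤ (∑' m : ℕ, ε m * (u m * w ^ m) * (1 / (1 - r))).re :=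
    ge_of_tendsto' hlim_re fun N => by
      have := hpd N
      rwa [hre N] at this
  -- identify the limit: `(1/(1-‖w‖²)) · Re (2 Σ u(m) w^m - u(0))`
  have hsumm : Summable fun m : ℕ => u m * w ^ m := by
    refine Summable.of_norm_bounded ((summable_geometric_of_lt_one (norm_nonneg _) hw).mul_left B) fun m => ?_
    rw [norm_mul, norm_pow]
    exact mul_le_mul_of_nonneg_right (hB m) (pow_nonneg (norm_nonneg _) _)
  have hr1 : (1 : ℂ) / (1 - r) = (((1 - ‖w‖ ^ 2)⁻¹ : ℝ) : ℂ) := by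
    rw [hr, Complex.mul_conj, Complex.normSq_eq_norm_sq]
    push_cast
    rw [one_div]
  have hid : ∑' m : ℕ, ε m * (u m * w ^ m) * (1 / (1 - r)) =
      (((1 - ‖w‖ ^ 2)⁻¹ : ℝ) : ℂ) * (2 * ∑' m : ℕ, u m * w ^ m - u 0) := by
    rw [tsum_mul_right, hr1, mul_comm]
    congr 1
    have hε2 : ∀ m, ε m * (u m * w ^ m) = 2 * (u m * w ^ m) - (if m = 0 then u 0 else 0) := by
      intro m
      simp only [hε]
      split_ifs with h
      · subst h; simp; ring
      · ring
    rw [tsum_congr hε2, Summable.tsum_sub (hsumm.mul_left 2) (summable_of_ne_finset_zero (s := {0})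
      (fun m hm => if_neg (by simpa using hm))), tsum_mul_left, tsum_ite_eq]
  rw [hid, Complex.re_ofReal_mul] at hnonneg
  exact nonneg_of_mul_nonneg_right hnonneg (inv_pos.2 hq1)

end Summit.RiemannHypothesis.RiemannHypothesis.Theorems.SignConeExactConeRigidity
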